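import Literature.MathematicalPhysics.QuantumLattice.AnisotropicSectors
import Literature.MathematicalPhysics.QuantumLattice.HubbardFermiChordRigidity
import Mathlib.Analysis.SpecialFunctions.Trigonometric.Bounds
import HarnessLib

/-!
# Momenta in an anisotropic sector: `|k'₁| ≤ Cγ^h`, `|k'₂| ≤ Cγ^{h/2}` (Benfatto–Giuliani–Mastropietro 2006, after (2.47))

Topic `Literature/MathematicalPhysics/QuantumLattice`; combines `AnisotropicSectors.lean` (the
cutoffs `F_{h,ω} = anisotropicCutoff e₀ μ n ω`, `h = -n`, `γ = 4`, with their scale support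
`|-ik₀ + ε - μ| < e₀γ^h` and angular support `|θ(k⃗) - θ_{h,ω} - 2πj| < ¾πγ^{h/2}`) with the sector
geometry of `HubbardFermiSectorGeometry.lean` (BGM 2003 Lemmas 7.2, 7.3: `radial_deviation_le`,
`abs_normalCoord_le`, `abs_tangentCoord_le`).

BGM 2006, §2.5 (p. 10): "Given any `k` belonging to the support of `F_{h,ω}(k)`, we put
`k⃗ = p⃗_F^{(h)}(θ_{h,ω}) + k'₁ n⃗_h(θ_{h,ω}) + k'₂ τ⃗_h(θ_{h,ω})` (2.46) … it is easy to realize that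
`|k'₁| ≤ Cγ^h` and `|k'₂| ≤ Cγ^{h/2}` for some constant `C`; see Lemma 7.3 of [BGM] for details."
PROVED here (for the fixed dispersion `ε`, `-4 < μ < -2-√2`, `0 < e₀ ≤ (4+μ)/2`, momenta with
`|k⃗| ≤ π/2`):

* `polar_repr` — `k⃗ = |k⃗| • dir(θ(k⃗))`;
* `norm_sq_gt_of_scaleCutoffFn_ne_zero` — on the support of `f_h`, `|k⃗|² > 4 + μ - e₀` (so
  `|k⃗| ≥ √((4+μ)/2)`: the shells stay away from the origin), from `ε(k⃗) ≤ -4 + |k⃗|²`;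
* `abs_norm_sub_fermiRadius_le` — **radial localisation** `| |k⃗| - u(θ(k⃗)) | ≤ C_r e₀ γ^h`,
  `C_r = π/(4√((4+μ)/2))` (BGM 2003 Lemma 7.2 applied to the scale support);
* `abs_normalCoord_le_of_ne_zero`, `abs_tangentCoord_le_of_ne_zero` — **the sector box**:
  if `F_{h,ω}(k) ≠ 0` then, in the frame at `θ_{h,ω}` (any lift `θ_{h,ω} + 2πj` gives the same
  frame), `|k'₁| ≤ C_r e₀ γ^h + C_n (¾ w_n)²` and `|k'₂| ≤ C_r e₀ γ^h + C_t (¾ w_n)` with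
  `w_n = π/2^n = πγ^{h/2}` (`w_n² = π²γ^h`), i.e. `|k'₁| ≤ Cγ^h`, `|k'₂| ≤ Cγ^{h/2}`; the constants
  `C_n = 2A₂√K/√(μ+4)`, `C_t = 2√K` are those of `HubbardFermiSectorGeometry`.

* `abs_grad_dot_fermiTangent_le_of_ne_zero` — **(2.53)–(2.54)**: on the support of `F_{h,ω}`
  the tangential derivative of the dispersion is small,
  `|∇ε(k⃗)·τ(θ_{h,ω})| ≤ 2√K a₂ (¾w_n) + 4 C_r e₀ γ^h = O(γ^{h/2})` (`a₂` the Lipschitz constant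
  of the Gauss map, Lemma 7.1): at the Fermi point `∇ε = 2c s' n(θ)` with `0 < c ≤ 1`
  (`sin_fermiX_eq`), `n(θ)·τ(θ_{h,ω}) = -sin(α(θ_{h,ω}) - α(θ))`, and `∇ε` is `2`-Lipschitz.

Everything is PROVED; no new definitions.

## Sources

* G. Benfatto, A. Giuliani, V. Mastropietro, Ann. Henri Poincaré 7 (2006) 809–898, §2.5
  (2.46)–(2.47) and the lines after (2.47) (arXiv:cond-mat/0507686 p. 10). [BenfattoGiulianiMastropietro2006]
* G. Benfatto, A. Giuliani, V. Mastropietro, Ann. Henri Poincaré 4 (2003) 137–193, §7.1,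
  Lemmas 7.2–7.3 (A1.12)–(A1.16). [BenfattoGiulianiMastropietro2003]
-/

noncomputable section

open Real Set Filter Complex
open scoped Topology

namespace Literature.MathematicalPhysics.QuantumLattice

/-! ### Polar representation and periodicity -/

/-- `k⃗ = |k⃗| • dir(θ(k⃗))`. [folklore] -/
theorem polar_repr (k : Fin 2 → ℝ) : k = ‖momToComplex k‖ • dir (polarAngle k) := by
  ext i
  fin_cases i
  · simp [norm_mul_cos_polarAngle]
  · simp [norm_mul_sin_polarAngle]

/-- `|k⃗|² = k₁² + k₂²`. [folklore] -/
theorem norm_momToComplex_sq (k : Fin 2 → ℝ) : ‖momToComplex k‖ ^ 2 = k 0 ^ 2 + k 1 ^ 2 := by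
  rw [Complex.sq_norm, Complex.normSq_apply, momToComplex_re, momToComplex_im]
  ring

/-- `dir` is `2π`-periodic. [folklore] -/
theorem dir_sub_two_pi_mul (θ : ℝ) (j : ℤ) : dir (θ - 2 * π * j) = dir θ := by
  have h1 : Real.cos (θ - 2 * π * j) = Real.cos θ := by
    rw [show θ - 2 * π * j = θ - (j : ℝ) * (2 * π) by ring, Real.cos_sub_int_mul_two_pi]
  have h2 : Real.sin (θ - 2 * π * j) = Real.sin θ := by
    rw [show θ - 2 * π * j = θ - (j : ℝ) * (2 * π) by ring, Real.sin_sub_int_mul_two_pi]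
  unfold dir
  rw [h1, h2]

section Range

variable {μ : ℝ} (hμ₁ : -4 < μ) (hμ₂ : μ < -2 - Real.sqrt 2)
include hμ₁ hμ₂

/-- The Fermi radius is `2π`-periodic. [folklore] -/
theorem fermiRadius_sub_two_pi_mul (θ : ℝ) (j : ℤ) : fermiRadius μ (θ - 2 * π * j) = fermiRadius μ θ := by
  -- both are the unique Fermi radius in the (same) direction
  have h1 := isFermiRadius_fermiRadius hμ₁ hμ₂ (θ - 2 * π * j)
  have h2 := isFermiRadius_fermiRadius hμ₁ hμ₂ θ
  rw [IsFermiRadius, dir_sub_two_pi_mul] at h1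
  exact (existsUnique_isFermiRadius hμ₁ hμ₂ θ).unique h1 h2

/-! ### The shells stay away from the origin -/

omit hμ₁ hμ₂ in
/-- `ε(k⃗) ≤ -4 + |k⃗|²` (from `cos x ≥ 1 - x²/2`). [folklore] -/
theorem sqDispersion_le_norm_sq (k : Fin 2 → ℝ) : sqDispersion k ≤ -4 + ‖momToComplex k‖ ^ 2 := by
  rw [norm_momToComplex_sq, sqDispersion]
  have h0 := Real.one_sub_sq_div_two_le_cos (x := k 0)
  have h1 := Real.one_sub_sq_div_two_le_cos (x := k 1)
  linarith

omit hμ₁ hμ₂ in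
/-- On the support of `f_h`: `|k⃗|² > 4 + μ - e₀`. [folklore] -/
theorem norm_sq_gt_of_scaleCutoffFn_ne_zero {e₀ : ℝ} (he : 0 < e₀) {n : ℕ} {k₀ : ℝ} {k : Fin 2 → ℝ}
    (h : scaleCutoffFn e₀ μ n (k₀, k) ≠ 0) : 4 + μ - e₀ < ‖momToComplex k‖ ^ 2 := by
  have hs := (scaleCutoffFn_ne_zero he h).2
  have h1 : (4 : ℝ) ^ (-(n : ℤ)) ≤ 1 := zpow_le_one_of_nonpos₀ (by norm_num) (by omega)
  have h2 : |sqDispersion k - μ| < e₀ :=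
    calc |sqDispersion k - μ| = Real.sqrt ((sqDispersion k - μ) ^ 2) := (Real.sqrt_sq_eq_abs _).symm
      _ ≤ Real.sqrt (k₀ ^ 2 + (sqDispersion k - μ) ^ 2) := Real.sqrt_le_sqrt (by nlinarith)
      _ < e₀ * (4 : ℝ) ^ (-(n : ℤ)) := hs
      _ ≤ e₀ := by nlinarith
  have h3 := sqDispersion_le_norm_sq k
  rw [abs_lt] at h2
  linarith

omit hμ₁ hμ₂ in
/-- Hence `|k⃗| ≥ √((4+μ)/2)` on the support of `f_h` when `e₀ ≤ (4+μ)/2`. [folklore] -/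
theorem sqrt_le_norm_of_scaleCutoffFn_ne_zero {e₀ : ℝ} (he : 0 < e₀) (he' : e₀ ≤ (4 + μ) / 2) {n : ℕ} {k₀ : ℝ}
    {k : Fin 2 → ℝ} (h : scaleCutoffFn e₀ μ n (k₀, k) ≠ 0) : Real.sqrt ((4 + μ) / 2) ≤ ‖momToComplex k‖ := by
  have h1 := norm_sq_gt_of_scaleCutoffFn_ne_zero he h
  refine Real.sqrt_le_iff.2 ⟨norm_nonneg _, ?_⟩
  linarith

/-! ### Radial localisation -/

/-- **Radial localisation on the support of `f_h`** (BGM 2003 Lemma 7.2 applied to the scale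
support): `| |k⃗| - u(θ(k⃗)) | ≤ (π / (4√((4+μ)/2))) e₀ γ^h` for `|k⃗| ≤ π/2`. [cite: BenfattoGiulianiMastropietro2003, §7.1 Lemma 7.2] -/
theorem abs_norm_sub_fermiRadius_le {e₀ : ℝ} (he : 0 < e₀) (he' : e₀ ≤ (4 + μ) / 2) {n : ℕ} {k₀ : ℝ}
    {k : Fin 2 → ℝ} (hk : ‖momToComplex k‖ ≤ π / 2) (h : scaleCutoffFn e₀ μ n (k₀, k) ≠ 0) :
    |‖momToComplex k‖ - fermiRadius μ (polarAngle k)| ≤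
      π / (4 * Real.sqrt ((4 + μ) / 2)) * (e₀ * (4 : ℝ) ^ (-(n : ℤ))) := by
  set ρ := ‖momToComplex k‖ with hρ
  set θ := polarAngle k
  set m₀ := Real.sqrt ((4 + μ) / 2) with hm₀
  have hm₀pos : 0 < m₀ := Real.sqrt_pos.2 (by linarith)
  have hρge : m₀ ≤ ρ := sqrt_le_norm_of_scaleCutoffFn_ne_zero he he' h
  have hρpos : 0 < ρ := lt_of_lt_of_le hm₀pos hρge
  have huge : m₀ ≤ fermiRadius μ θ := le_trans (Real.sqrt_le_sqrt (by linarith)) (sqrt_le_fermiRadius hμ₁ hμ₂ θ)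
  have hmin : m₀ ≤ min ρ (fermiRadius μ θ) := le_min hρge huge
  -- Lemma 7.2 with the scale support
  have hdev := radial_deviation_le hμ₁ hμ₂ θ hρpos hk
  have hrepr : ρ • dir θ = k := (polar_repr k).symm
  rw [hrepr] at hdev
  have hs := (scaleCutoffFn_ne_zero he h).2
  have he2 : |sqDispersion k - μ| < e₀ * (4 : ℝ) ^ (-(n : ℤ)) :=
    calc |sqDispersion k - μ| = Real.sqrt ((sqDispersion k - μ) ^ 2) := (Real.sqrt_sq_eq_abs _).symm
      _ ≤ Real.sqrt (k₀ ^ 2 + (sqDispersion k - μ) ^ 2) := Real.sqrt_le_sqrt (by nlinarith)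
      _ < _ := hs
  -- `(4/π) m₀ |ρ - u| ≤ (4/π) min(ρ,u) |ρ - u| ≤ |ε - μ| < e₀ γ^h`
  have h1 : 4 / π * m₀ * |ρ - fermiRadius μ θ| ≤ e₀ * (4 : ℝ) ^ (-(n : ℤ)) :=
    le_trans (by gcongr) (hdev.trans he2.le)
  rw [div_mul_eq_mul_div, le_div_iff₀ (by positivity)]
  calc |ρ - fermiRadius μ θ| * (4 * m₀) = π * (4 / π * m₀ * |ρ - fermiRadius μ θ|) := by
        field_simp
    _ ≤ π * (e₀ * (4 : ℝ) ^ (-(n : ℤ))) := mul_le_mul_of_nonneg_left h1 pi_pos.le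

/-! ### The sector box -/

/-- **Normal extent of a sector** (BGM 2006 after (2.47), `|k'₁| ≤ Cγ^h`): if `F_{h,ω}(k) ≠ 0`,
`|k⃗| ≤ π/2`, then for the lift `j` of the angular support,
`|k'₁| ≤ C_r e₀ γ^h + C_n (θ(k⃗) - 2πj - θ_{h,ω})²` with `|θ(k⃗) - 2πj - θ_{h,ω}| < ¾w_n`, hence
`|k'₁| ≤ C_r e₀γ^h + C_n (¾ w_n)²` (`w_n² = π²γ^h`). [cite: BenfattoGiulianiMastropietro2006, §2.5 (2.46)–(2.47)] -/
theorem abs_normalCoord_le_of_ne_zero {e₀ : ℝ} (he : 0 < e₀) (he' : e₀ ≤ (4 + μ) / 2) {n : ℕ} {ω : ℤ}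
    {k₀ : ℝ} {k : Fin 2 → ℝ} (hk : ‖momToComplex k‖ ≤ π / 2) (h : anisotropicCutoff e₀ μ n ω (k₀, k) ≠ 0) :
    |normalCoord μ (((ω : ℝ) + 1 / 2) * sectorWidth n) k| ≤
      π / (4 * Real.sqrt ((4 + μ) / 2)) * (e₀ * (4 : ℝ) ^ (-(n : ℤ))) +
        2 * accelBound μ * Real.sqrt (π ^ 2 / 8 + (4 * π ^ 3 / (μ + 4)) ^ 2) / Real.sqrt (μ + 4) *
          (3 * sectorWidth n / 4) ^ 2 := by
  obtain ⟨j, hj⟩ := anisotropicCutoff_ne_zero_angle h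
  have hf : scaleCutoffFn e₀ μ n (k₀, k) ≠ 0 := left_ne_zero_of_mul h
  have hrad := abs_norm_sub_fermiRadius_le hμ₁ hμ₂ he he' hk hf
  set θ₀ := ((ω : ℝ) + 1 / 2) * sectorWidth n
  set θ' := polarAngle k - 2 * π * j with hθ'
  -- `k = ρ • dir θ'` and `u(θ') = u(θ(k))`
  have hrepr : k = ‖momToComplex k‖ • dir θ' := by rw [hθ', dir_sub_two_pi_mul]; exact polar_repr k
  have hu : fermiRadius μ θ' = fermiRadius μ (polarAngle k) := fermiRadius_sub_two_pi_mul hμ₁ hμ₂ _ _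
  have hgeo := abs_normalCoord_le hμ₁ hμ₂ θ₀ θ' ‖momToComplex k‖
  rw [← hrepr, hu] at hgeo
  have hang : |θ' - θ₀| ≤ 3 * sectorWidth n / 4 := by
    rw [hθ']; rw [show polarAngle k - 2 * π * j - θ₀ = polarAngle k - θ₀ - 2 * π * j by ring]; exact hj.le
  have hsq : (θ' - θ₀) ^ 2 ≤ (3 * sectorWidth n / 4) ^ 2 := by
    rw [← sq_abs]; exact pow_le_pow_left₀ (abs_nonneg _) hang 2
  have hC : 0 ≤ 2 * accelBound μ * Real.sqrt (π ^ 2 / 8 + (4 * π ^ 3 / (μ + 4)) ^ 2) / Real.sqrt (μ + 4) := by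
    have hA : 0 ≤ accelBound μ := (abs_nonneg _).trans (abs_fermiAX_le hμ₁ hμ₂ 0)
    positivity
  calc _ ≤ _ := hgeo
    _ ≤ _ := add_le_add hrad (mul_le_mul_of_nonneg_left hsq hC)

/-- **Tangential extent of a sector** (BGM 2006 after (2.47), `|k'₂| ≤ Cγ^{h/2}`): under the same
hypotheses `|k'₂| ≤ C_r e₀ γ^h + 2√K · ¾ w_n`. [cite: BenfattoGiulianiMastropietro2006, §2.5 (2.46)–(2.47)] -/
theorem abs_tangentCoord_le_of_ne_zero {e₀ : ℝ} (he : 0 < e₀) (he' : e₀ ≤ (4 + μ) / 2) {n : ℕ} {ω : ℤ}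
    {k₀ : ℝ} {k : Fin 2 → ℝ} (hk : ‖momToComplex k‖ ≤ π / 2) (h : anisotropicCutoff e₀ μ n ω (k₀, k) ≠ 0) :
    |tangentCoord μ (((ω : ℝ) + 1 / 2) * sectorWidth n) k| ≤
      π / (4 * Real.sqrt ((4 + μ) / 2)) * (e₀ * (4 : ℝ) ^ (-(n : ℤ))) +
        2 * Real.sqrt (π ^ 2 / 8 + (4 * π ^ 3 / (μ + 4)) ^ 2) * (3 * sectorWidth n / 4) := by
  obtain ⟨j, hj⟩ := anisotropicCutoff_ne_zero_angle h
  have hf : scaleCutoffFn e₀ μ n (k₀, k) ≠ 0 := left_ne_zero_of_mul h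
  have hrad := abs_norm_sub_fermiRadius_le hμ₁ hμ₂ he he' hk hf
  set θ₀ := ((ω : ℝ) + 1 / 2) * sectorWidth n
  set θ' := polarAngle k - 2 * π * j with hθ'
  have hrepr : k = ‖momToComplex k‖ • dir θ' := by rw [hθ', dir_sub_two_pi_mul]; exact polar_repr k
  have hu : fermiRadius μ θ' = fermiRadius μ (polarAngle k) := fermiRadius_sub_two_pi_mul hμ₁ hμ₂ _ _
  have hgeo := abs_tangentCoord_le hμ₁ hμ₂ θ₀ θ' ‖momToComplex k‖
  rw [← hrepr, hu] at hgeo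
  have hang : |θ' - θ₀| ≤ 3 * sectorWidth n / 4 := by
    rw [hθ']; rw [show polarAngle k - 2 * π * j - θ₀ = polarAngle k - θ₀ - 2 * π * j by ring]; exact hj.le
  calc _ ≤ _ := hgeo
    _ ≤ _ := add_le_add hrad (mul_le_mul_of_nonneg_left hang (by positivity))

/-! ### The tangential derivative of the dispersion on a sector (BGM 2006 (2.53)–(2.54)) -/

/-- At the Fermi point: `∇ε(p_F(θ))·τ(θ₀) = -2 c(θ) s'(θ) sin(α(θ₀) - α(θ))`. [cite: BenfattoGiulianiMastropietro2006, §2.5 (2.54)] -/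
theorem grad_fermi_dot_fermiTangent (θ θ₀ : ℝ) :
    2 * Real.sin (fermiX μ θ) * fermiTangent μ θ₀ 0 + 2 * Real.sin (fermiY μ θ) * fermiTangent μ θ₀ 1 =
      -(2 * normalCoeff μ θ * fermiSpeed μ θ * Real.sin (normalAngle μ θ₀ - normalAngle μ θ)) := by
  have hs₀ := fermiSpeed_pos hμ₁ hμ₂ θ₀
  have hcross := fermiV_cross_eq hμ₁ hμ₂ θ θ₀
  rw [sin_fermiX_eq hμ₁ hμ₂, sin_fermiY_eq hμ₁ hμ₂]
  simp only [fermiTangent, Pi.smul_apply, smul_eq_mul, Matrix.cons_val_zero, Matrix.cons_val_one]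
  field_simp
  linear_combination (-normalCoeff μ θ) * hcross

/-- Hence `|∇ε(p_F(θ))·τ(θ₀)| ≤ 2√K·|α(θ₀) - α(θ)|`. [cite: BenfattoGiulianiMastropietro2006, §2.5 (2.54)] -/
theorem abs_grad_fermi_dot_fermiTangent_le (θ θ₀ : ℝ) :
    |2 * Real.sin (fermiX μ θ) * fermiTangent μ θ₀ 0 + 2 * Real.sin (fermiY μ θ) * fermiTangent μ θ₀ 1| ≤
      2 * Real.sqrt (π ^ 2 / 8 + (4 * π ^ 3 / (μ + 4)) ^ 2) * |normalAngle μ θ₀ - normalAngle μ θ| := by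
  rw [grad_fermi_dot_fermiTangent hμ₁ hμ₂, abs_neg]
  have hc0 := (normalCoeff_pos hμ₁ hμ₂ θ).le
  have hc1 := normalCoeff_le_one hμ₁ hμ₂ θ
  have hs := (fermiSpeed_pos hμ₁ hμ₂ θ).le
  have hsK := fermiSpeed_le hμ₁ hμ₂ θ
  have hsin : |Real.sin (normalAngle μ θ₀ - normalAngle μ θ)| ≤ |normalAngle μ θ₀ - normalAngle μ θ| :=
    Real.abs_sin_le_abs
  rw [abs_mul, abs_mul, abs_mul, abs_of_nonneg hc0, abs_of_nonneg hs, abs_two]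
  calc 2 * normalCoeff μ θ * fermiSpeed μ θ * |Real.sin (normalAngle μ θ₀ - normalAngle μ θ)|
      ≤ 2 * 1 * Real.sqrt (π ^ 2 / 8 + (4 * π ^ 3 / (μ + 4)) ^ 2) * |normalAngle μ θ₀ - normalAngle μ θ| := by
        gcongr
    _ = _ := by ring

omit hμ₁ hμ₂ in
/-- `∇ε = (2 sin k₁, 2 sin k₂)` is `2`-Lipschitz in each component along the ray:
`|sin(ρ cos θ) - sin(u cos θ)| ≤ |ρ - u|`. [folklore] -/
theorem abs_sin_mul_sub_sin_mul_le (ρ u c : ℝ) (hc : |c| ≤ 1) :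
    |Real.sin (ρ * c) - Real.sin (u * c)| ≤ |ρ - u| :=
  calc |Real.sin (ρ * c) - Real.sin (u * c)| ≤ |ρ * c - u * c| := Real.abs_sin_sub_sin_le _ _
    _ = |ρ - u| * |c| := by rw [← sub_mul, abs_mul]
    _ ≤ |ρ - u| := mul_le_of_le_one_right (abs_nonneg _) hc

/-- **BGM 2006 (2.53)–(2.54): the tangential derivative of the dispersion is `O(γ^{h/2})` on a
sector.** If `F_{h,ω}(k) ≠ 0` and `|k⃗| ≤ π/2` then
`|∇ε(k⃗)·τ(θ_{h,ω})| ≤ 2√K a₂ (¾ w_n) + 4 C_r e₀ γ^h`, where `a₂` is the upper Lipschitz constant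
of the Gauss map `θ ↦ α(θ)` (Lemma 7.1, `normalAngle_bilipschitz`), `C_r = π/(4√((4+μ)/2))`. [cite: BenfattoGiulianiMastropietro2006, §2.5 (2.53)–(2.54)] -/
theorem abs_grad_dot_fermiTangent_le_of_ne_zero {e₀ : ℝ} (he : 0 < e₀) (he' : e₀ ≤ (4 + μ) / 2) :
    ∃ a₂ : ℝ, 0 < a₂ ∧ ∀ {n : ℕ} {ω : ℤ} {k₀ : ℝ} {k : Fin 2 → ℝ}, ‖momToComplex k‖ ≤ π / 2 →
      anisotropicCutoff e₀ μ n ω (k₀, k) ≠ 0 →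
        |2 * Real.sin (k 0) * fermiTangent μ (((ω : ℝ) + 1 / 2) * sectorWidth n) 0 +
            2 * Real.sin (k 1) * fermiTangent μ (((ω : ℝ) + 1 / 2) * sectorWidth n) 1| ≤
          2 * Real.sqrt (π ^ 2 / 8 + (4 * π ^ 3 / (μ + 4)) ^ 2) * a₂ * (3 * sectorWidth n / 4) +
            4 * (π / (4 * Real.sqrt ((4 + μ) / 2)) * (e₀ * (4 : ℝ) ^ (-(n : ℤ)))) := by
  obtain ⟨a₁, a₂, ha₁, ha₁₂, hbil⟩ := normalAngle_bilipschitz hμ₁ hμ₂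
  refine ⟨a₂, lt_of_lt_of_le ha₁ ha₁₂, fun {n ω k₀ k} hk h => ?_⟩
  obtain ⟨j, hj⟩ := anisotropicCutoff_ne_zero_angle h
  have hf : scaleCutoffFn e₀ μ n (k₀, k) ≠ 0 := left_ne_zero_of_mul h
  have hrad := abs_norm_sub_fermiRadius_le hμ₁ hμ₂ he he' hk hf
  set θ₀ := ((ω : ℝ) + 1 / 2) * sectorWidth n
  set θ' := polarAngle k - 2 * π * j with hθ'
  set ρ := ‖momToComplex k‖
  set u := fermiRadius μ θ'
  have hu : u = fermiRadius μ (polarAngle k) := fermiRadius_sub_two_pi_mul hμ₁ hμ₂ _ _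
  have hrepr : k = ρ • dir θ' := by rw [hθ', dir_sub_two_pi_mul]; exact polar_repr k
  have hk0 : k 0 = ρ * Real.cos θ' := by rw [hrepr]; simp
  have hk1 : k 1 = ρ * Real.sin θ' := by rw [hrepr]; simp
  -- the Fermi point in direction `θ'`
  have hx : fermiX μ θ' = u * Real.cos θ' := rfl
  have hy : fermiY μ θ' = u * Real.sin θ' := rfl
  have hρu : |ρ - u| ≤ π / (4 * Real.sqrt ((4 + μ) / 2)) * (e₀ * (4 : ℝ) ^ (-(n : ℤ))) := by rw [hu]; exact hrad
  -- tangent components are bounded by `1`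
  have hτ := fermiTangent_normSq hμ₁ hμ₂ θ₀
  have hτ0 : |fermiTangent μ θ₀ 0| ≤ 1 := abs_le_one_iff_mul_self_le_one.2 (by nlinarith [sq_nonneg (fermiTangent μ θ₀ 1)])
  have hτ1 : |fermiTangent μ θ₀ 1| ≤ 1 := abs_le_one_iff_mul_self_le_one.2 (by nlinarith [sq_nonneg (fermiTangent μ θ₀ 0)])
  -- split `∇ε(k) = ∇ε(p_F(θ')) + (∇ε(k) - ∇ε(p_F(θ')))`
  have hsplit : 2 * Real.sin (k 0) * fermiTangent μ θ₀ 0 + 2 * Real.sin (k 1) * fermiTangent μ θ₀ 1 =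
      (2 * Real.sin (fermiX μ θ') * fermiTangent μ θ₀ 0 + 2 * Real.sin (fermiY μ θ') * fermiTangent μ θ₀ 1) +
        (2 * (Real.sin (k 0) - Real.sin (fermiX μ θ')) * fermiTangent μ θ₀ 0 +
          2 * (Real.sin (k 1) - Real.sin (fermiY μ θ')) * fermiTangent μ θ₀ 1) := by ring
  have hA := abs_grad_fermi_dot_fermiTangent_le hμ₁ hμ₂ θ' θ₀
  have hα : |normalAngle μ θ₀ - normalAngle μ θ'| ≤ a₂ * (3 * sectorWidth n / 4) := by
    refine ((hbil θ' θ₀).2).trans (mul_le_mul_of_nonneg_left ?_ (lt_of_lt_of_le ha₁ ha₁₂).le)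
    rw [abs_sub_comm, hθ', show polarAngle k - 2 * π * j - θ₀ = polarAngle k - θ₀ - 2 * π * j by ring]
    exact hj.le
  have hB0 : |Real.sin (k 0) - Real.sin (fermiX μ θ')| ≤ |ρ - u| := by
    rw [hk0, hx]; exact abs_sin_mul_sub_sin_mul_le _ _ _ (Real.abs_cos_le_one _)
  have hB1 : |Real.sin (k 1) - Real.sin (fermiY μ θ')| ≤ |ρ - u| := by
    rw [hk1, hy]; exact abs_sin_mul_sub_sin_mul_le _ _ _ (Real.abs_sin_le_one _)
  have hB : |2 * (Real.sin (k 0) - Real.sin (fermiX μ θ')) * fermiTangent μ θ₀ 0 +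
      2 * (Real.sin (k 1) - Real.sin (fermiY μ θ')) * fermiTangent μ θ₀ 1| ≤ 4 * |ρ - u| := by
    have h0 : |2 * (Real.sin (k 0) - Real.sin (fermiX μ θ')) * fermiTangent μ θ₀ 0| ≤ 2 * |ρ - u| := by
      rw [abs_mul, abs_mul, abs_two]
      calc 2 * |Real.sin (k 0) - Real.sin (fermiX μ θ')| * |fermiTangent μ θ₀ 0| ≤ 2 * |ρ - u| * 1 := by
            gcongr
        _ = 2 * |ρ - u| := mul_one _
    have h1 : |2 * (Real.sin (k 1) - Real.sin (fermiY μ θ')) * fermiTangent μ θ₀ 1| ≤ 2 * |ρ - u| := by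
      rw [abs_mul, abs_mul, abs_two]
      calc 2 * |Real.sin (k 1) - Real.sin (fermiY μ θ')| * |fermiTangent μ θ₀ 1| ≤ 2 * |ρ - u| * 1 := by
            gcongr
        _ = 2 * |ρ - u| := mul_one _
    calc _ ≤ _ := abs_add_le _ _
      _ ≤ 2 * |ρ - u| + 2 * |ρ - u| := add_le_add h0 h1
      _ = 4 * |ρ - u| := by ring
  have hK : 0 ≤ 2 * Real.sqrt (π ^ 2 / 8 + (4 * π ^ 3 / (μ + 4)) ^ 2) := by positivity
  rw [hsplit]
  calc _ ≤ _ := abs_add_le _ _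
    _ ≤ 2 * Real.sqrt (π ^ 2 / 8 + (4 * π ^ 3 / (μ + 4)) ^ 2) * (a₂ * (3 * sectorWidth n / 4)) + 4 * |ρ - u| :=
        add_le_add (hA.trans (mul_le_mul_of_nonneg_left hα hK)) hB
    _ ≤ _ := by nlinarith [hρu]

omit hμ₁ hμ₂ in
/-- The sector widths square to the scale: `w_n² = π² γ^h` (`γ = 4`, `h = -n`), so the bounds above
read `|k'₁| ≤ Cγ^h`, `|k'₂| ≤ Cγ^{h/2}`. [cite: BenfattoGiulianiMastropietro2006, §2.5 (2.44)] -/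
theorem sectorWidth_sq_eq (n : ℕ) : sectorWidth n ^ 2 = π ^ 2 * (4 : ℝ) ^ (-(n : ℤ)) := by
  rw [sectorWidth, div_pow, zpow_neg, zpow_natCast, show (4 : ℝ) ^ n = (2 ^ n) ^ 2 by
    rw [← pow_mul, show (4 : ℝ) = 2 ^ 2 by norm_num, ← pow_mul, mul_comm]]
  field_simp

end Range

end Literature.MathematicalPhysics.QuantumLattice

end
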